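import Summits.CriticalPhenomena.PercolationContinuityZ3.Theorems.PercNearOneGluingNoHeavyPcintOSMRenewal
import HarnessLib

/-!
# PCINT lane, PHASE 5 (block-renewal second moment), step 2: blocks, pair sums and the potential bound

Cell `prim-pcint`, seat `prim-pcint-1` (gen 14); memo `run/shared/lean/prim/pcint/T-FIBRE-ROUTE.md` §PHASE 5.

A BLOCK of a semi-oriented path in `ℤ^{k+t} = ℤ^k × ℤ^t` is a transverse piece (a list of signed transverse axes,
read from a finite piece table `pc : Fin np → List (Fin t × Bool)`) followed by one step along a time axis
`a : Fin k`.  Two block paths started at relative offset `o = (τ, y)` (time offset, transverse offset) share, in their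
first blocks `b, b'`, exactly `Rloc pc o b b'` edges (`0` unless `τ = 0`; then the common local edge keys after shifting
`b'` by `y`), and the offset of their next blocks is `o + δ pc b b'`.  With block weights `ν b = w b.1 / k` the PAIR SUM

  `A x n o = Σ_{β,β' : Fin n → Blk} ν(β) ν(β') x^{Σ_j Rloc (o_j) (β j) (β' j)}`   (`BSM.A`)

satisfies the first-block recursion `BSM.A_succ`, and the transition sums `BSM.Pn` (the same with `x = 1` and a target
offset) the recursion `BSM.Pn_succ`.  **`BSM.A_le_of_cert`**: if `x ≥ 1`, the rewards vanish outside a finite set `B` of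
offsets, `Ĝ o z` dominates every partial Green sum `Σ_{i<m} Pn i o z` (`z ∈ B`), and a nonnegative `φ` on `B` with a
constant `c > 0` passes the finite check

  `Σ_{b,b'} ν b ν b' (x^{Rloc o b b'} - 1) (c + Σ_{z ∈ B} Ĝ (o + δ b b') z φ z) ≤ φ o`   for all `o ∈ B`,

then `A x n 0 ≤ (c + Σ_{z∈B} Ĝ 0 z φ z) / c` for every `n` (a supermartingale / Lyapunov argument with the
finite-horizon potentials `V_m = c + Σ_z (Σ_{i<m} Pn i · z) φ z`; no infinite sums).  Everything is stated for a
generic local count `R` (bond: `BSM.Rloc`, edge keys; site: `BSM.RlocS`, vertex keys).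
-/

noncomputable section

namespace Summit.CriticalPhenomena.PercolationContinuityZ3.Theorems.Pcint.BSM

open Finset OSM

variable {t k np : ℕ}

/-! ### Pieces, local edge and vertex keys -/

/-- The step vector `± e_i ∈ ℤ^t` of a signed transverse axis. -/
def sv (q : Fin t × Bool) : Fin t → ℤ := Pi.single q.1 (if q.2 then 1 else -1)

/-- The endpoint of a piece (sum of its step vectors). -/
def pend (σ : List (Fin t × Bool)) : Fin t → ℤ := (σ.map sv).sum

/-- Local edge keys (lower vertex, axis): transverse axes `inl`, time axes `inr`. -/
abbrev LKey (t k : ℕ) := (Fin t → ℤ) × (Fin t ⊕ Fin k)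

/-- Local vertex keys (time displacement, transverse position). -/
abbrev VKey (t k : ℕ) := (Fin k → ℤ) × (Fin t → ℤ)

/-- The edge keys of the transverse steps of a piece started at `u`. -/
def tedges (k : ℕ) : (Fin t → ℤ) → List (Fin t × Bool) → Finset (LKey t k)
  | _, [] => ∅
  | u, q :: σ => insert (if q.2 then (u, Sum.inl q.1) else (u + sv q, Sum.inl q.1)) (tedges k (u + sv q) σ)

/-- The vertices entered by the transverse steps of a piece started at `u` (time displacement `0`). -/
def tverts (k : ℕ) : (Fin t → ℤ) → List (Fin t × Bool) → Finset (VKey t k)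
  | _, [] => ∅
  | u, q :: σ => insert (0, u + sv q) (tverts k (u + sv q) σ)

/-- A block: a piece index and a time axis. -/
abbrev Blk (np k : ℕ) := Fin np × Fin k

/-- **Local edge keys of a block**: its transverse steps and its final time step. -/
def Eloc (pc : Fin np → List (Fin t × Bool)) (b : Blk np k) : Finset (LKey t k) :=
  insert (pend (pc b.1), Sum.inr b.2) (tedges k 0 (pc b.1))

/-- **Local vertex keys of a block**: the vertices entered by its steps (the last one is the next block's start). -/
def Vloc (pc : Fin np → List (Fin t × Bool)) (b : Blk np k) : Finset (VKey t k) :=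
  insert (e b.2, pend (pc b.1)) (tverts k 0 (pc b.1))

/-- Shifting edge keys by a transverse vector. -/
def shiftE (y : Fin t → ℤ) : LKey t k ↪ LKey t k :=
  ⟨fun q => (q.1 + y, q.2), fun q q' h => by
    simp only [Prod.mk.injEq, add_left_inj] at h; exact Prod.ext h.1 h.2⟩

/-- Shifting vertex keys by a transverse vector. -/
def shiftV (y : Fin t → ℤ) : VKey t k ↪ VKey t k :=
  ⟨fun q => (q.1, q.2 + y), fun q q' h => by
    simp only [Prod.mk.injEq, add_left_inj] at h; exact Prod.ext h.1 h.2⟩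

/-- Offsets between two walkers: (time offset, transverse offset). -/
abbrev Off (t k : ℕ) := (Fin k → ℤ) × (Fin t → ℤ)

/-- **Shared edges of the first blocks** at offset `o`: none unless the time offset vanishes, then the common local
edge keys of `b` and of `b'` shifted by the transverse offset. -/
def Rloc (pc : Fin np → List (Fin t × Bool)) (o : Off t k) (b b' : Blk np k) : ℕ :=
  if o.1 = 0 then (Eloc pc b ∩ (Eloc pc b').map (shiftE o.2)).card else 0

/-- **Shared vertices of the first blocks** at offset `o` (site version). -/
def RlocS (pc : Fin np → List (Fin t × Bool)) (o : Off t k) (b b' : Blk np k) : ℕ :=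
  if o.1 = 0 then (Vloc pc b ∩ (Vloc pc b').map (shiftV o.2)).card else 0

/-- **The offset increment** of a pair of blocks. -/
def δ (pc : Fin np → List (Fin t × Bool)) (b b' : Blk np k) : Off t k :=
  (e b'.2 - e b.2, pend (pc b'.1) - pend (pc b.1))

/-! ### Block words, offsets along them, pair sums -/

/-- The offset before block `j` of two block words started at offset `o`. -/
def offAt (pc : Fin np → List (Fin t × Bool)) {n : ℕ} (o : Off t k) (β β' : Fin n → Blk np k) (j : ℕ) : Off t k :=
  o + ∑ i : Fin n, if (i : ℕ) < j then δ pc (β i) (β' i) else 0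

/-- **Total shared count** along two block words (with a local count `R`). -/
def Ksh (R : Off t k → Blk np k → Blk np k → ℕ) (pc : Fin np → List (Fin t × Bool)) {n : ℕ} (o : Off t k)
    (β β' : Fin n → Blk np k) : ℕ :=
  ∑ j : Fin n, R (offAt pc o β β' j) (β j) (β' j)

/-- The weight of a block word. -/
def wt' (ν : Blk np k → ℝ) {n : ℕ} (β : Fin n → Blk np k) : ℝ := ∏ j, ν (β j)

/-- **The pair sum** `A = Σ_{β,β'} ν(β) ν(β') x^{Ksh}` from offset `o` (generic local count `R`). -/
def A (R : Off t k → Blk np k → Blk np k → ℕ) (pc : Fin np → List (Fin t × Bool)) (ν : Blk np k → ℝ)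
    (x : ℝ) (n : ℕ) (o : Off t k) : ℝ :=
  ∑ β : Fin n → Blk np k, ∑ β' : Fin n → Blk np k, wt' ν β * wt' ν β' * x ^ Ksh R pc o β β'

/-- **The transition sums** `Pn n o z = Σ_{β,β'} ν(β) ν(β') 𝟙[offset after n blocks = z]`. -/
def Pn (pc : Fin np → List (Fin t × Bool)) (ν : Blk np k → ℝ) (n : ℕ) (o z : Off t k) : ℝ :=
  ∑ β : Fin n → Blk np k, ∑ β' : Fin n → Blk np k, wt' ν β * wt' ν β' * if offAt pc o β β' n = z then 1 else 0

/-- Sums over words of length `n+1` by first letter (any finite alphabet). -/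
theorem sum_cons {α L : Type*} [Fintype L] [AddCommMonoid α] {n : ℕ} (f : (Fin (n + 1) → L) → α) :
    ∑ w : Fin (n + 1) → L, f w = ∑ a : L, ∑ w : Fin n → L, f (Fin.cons a w) := by
  rw [← (Fin.consEquiv fun _ => L).sum_comp f, Fintype.sum_prod_type]
  rfl

/-- Nothing has happened before the first block. -/
theorem offAt_zero (pc : Fin np → List (Fin t × Bool)) {n : ℕ} (o : Off t k) (β β' : Fin n → Blk np k) :
    offAt pc o β β' 0 = o := by
  simp [offAt]

/-- First-block recursion of the offsets. -/
theorem offAt_cons_succ (pc : Fin np → List (Fin t × Bool)) {n : ℕ} (o : Off t k) (b b' : Blk np k)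
    (β β' : Fin n → Blk np k) (j : ℕ) :
    offAt pc o (Fin.cons b β : Fin (n + 1) → Blk np k) (Fin.cons b' β') (j + 1) = offAt pc (o + δ pc b b') β β' j := by
  simp only [offAt, Fin.sum_univ_succ, Fin.cons_zero, Fin.cons_succ, Fin.val_zero, Nat.zero_lt_succ, if_true,
    Fin.val_succ, Nat.succ_lt_succ_iff, add_assoc]

/-- First-block recursion of the shared count. -/
theorem Ksh_cons (R : Off t k → Blk np k → Blk np k → ℕ) (pc : Fin np → List (Fin t × Bool)) {n : ℕ} (o : Off t k)
    (b b' : Blk np k) (β β' : Fin n → Blk np k) :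
    Ksh R pc o (Fin.cons b β : Fin (n + 1) → Blk np k) (Fin.cons b' β') = R o b b' + Ksh R pc (o + δ pc b b') β β' := by
  rw [Ksh, Ksh, Fin.sum_univ_succ]
  simp only [Fin.cons_zero, Fin.cons_succ, Fin.val_zero, offAt_zero, Fin.val_succ, offAt_cons_succ]

/-- The weight of a word by first letter. -/
theorem wt'_cons (ν : Blk np k → ℝ) {n : ℕ} (b : Blk np k) (β : Fin n → Blk np k) :
    wt' ν (Fin.cons b β : Fin (n + 1) → Blk np k) = ν b * wt' ν β := by
  rw [wt', wt', Fin.prod_univ_succ]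
  simp only [Fin.cons_zero, Fin.cons_succ]

/-- The weight of the empty word. -/
theorem wt'_zero (ν : Blk np k → ℝ) (β : Fin 0 → Blk np k) : wt' ν β = 1 := by
  simp [wt']

/-- `A` at `n = 0`. -/
theorem A_zero (R : Off t k → Blk np k → Blk np k → ℕ) (pc : Fin np → List (Fin t × Bool)) (ν : Blk np k → ℝ)
    (x : ℝ) (o : Off t k) : A R pc ν x 0 o = 1 := by
  simp [A, wt'_zero, Ksh]

/-- **First-block recursion of the pair sum.** -/
theorem A_succ (R : Off t k → Blk np k → Blk np k → ℕ) (pc : Fin np → List (Fin t × Bool)) (ν : Blk np k → ℝ)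
    (x : ℝ) (n : ℕ) (o : Off t k) :
    A R pc ν x (n + 1) o = ∑ b : Blk np k, ∑ b' : Blk np k, ν b * ν b' * x ^ R o b b' * A R pc ν x n (o + δ pc b b') := by
  unfold A
  rw [sum_cons]
  refine sum_congr rfl fun b _ => ?_
  simp_rw [sum_cons (fun β' => wt' ν (Fin.cons b _) * wt' ν β' * x ^ Ksh R pc o (Fin.cons b _) β')]
  rw [sum_comm]
  refine sum_congr rfl fun b' _ => ?_
  rw [mul_sum]
  refine sum_congr rfl fun β _ => ?_
  rw [mul_sum]
  refine sum_congr rfl fun β' _ => ?_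
  rw [wt'_cons, wt'_cons, Ksh_cons, pow_add]
  ring

/-- `Pn` at `n = 0`. -/
theorem Pn_zero (pc : Fin np → List (Fin t × Bool)) (ν : Blk np k → ℝ) (o z : Off t k) :
    Pn pc ν 0 o z = if o = z then 1 else 0 := by
  simp [Pn, wt'_zero, offAt_zero]

/-- **First-block recursion of the transition sums.** -/
theorem Pn_succ (pc : Fin np → List (Fin t × Bool)) (ν : Blk np k → ℝ) (n : ℕ) (o z : Off t k) :
    Pn pc ν (n + 1) o z = ∑ b : Blk np k, ∑ b' : Blk np k, ν b * ν b' * Pn pc ν n (o + δ pc b b') z := by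
  unfold Pn
  rw [sum_cons]
  refine sum_congr rfl fun b _ => ?_
  simp_rw [sum_cons (fun β' : Fin (n + 1) → Blk np k =>
    wt' ν (Fin.cons b _) * wt' ν β' * if offAt pc o (Fin.cons b _) β' (n + 1) = z then (1 : ℝ) else 0)]
  rw [sum_comm]
  refine sum_congr rfl fun b' _ => ?_
  rw [mul_sum]
  refine sum_congr rfl fun β _ => ?_
  rw [mul_sum]
  refine sum_congr rfl fun β' _ => ?_
  rw [wt'_cons, wt'_cons, offAt_cons_succ]
  ring

/-- `Pn ≥ 0` for nonnegative weights. -/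
theorem Pn_nonneg (pc : Fin np → List (Fin t × Bool)) {ν : Blk np k → ℝ} (hν : ∀ b, 0 ≤ ν b) (n : ℕ) (o z : Off t k) :
    0 ≤ Pn pc ν n o z :=
  sum_nonneg fun _ _ => sum_nonneg fun _ _ => mul_nonneg (mul_nonneg (prod_nonneg fun _ _ => hν _)
    (prod_nonneg fun _ _ => hν _)) (by split_ifs <;> norm_num)

/-- `A ≥ 0` for nonnegative weights and `x ≥ 0`. -/
theorem A_nonneg (R : Off t k → Blk np k → Blk np k → ℕ) (pc : Fin np → List (Fin t × Bool)) {ν : Blk np k → ℝ}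
    (hν : ∀ b, 0 ≤ ν b) {x : ℝ} (hx : 0 ≤ x) (n : ℕ) (o : Off t k) : 0 ≤ A R pc ν x n o :=
  sum_nonneg fun _ _ => sum_nonneg fun _ _ => mul_nonneg (mul_nonneg (prod_nonneg fun _ _ => hν _)
    (prod_nonneg fun _ _ => hν _)) (pow_nonneg hx _)

/-! ### The potential bound -/

/-- The partial Green sums `Gm m o z = Σ_{i<m} Pn i o z`. -/
def Gm (pc : Fin np → List (Fin t × Bool)) (ν : Blk np k → ℝ) (m : ℕ) (o z : Off t k) : ℝ :=
  ∑ i ∈ range m, Pn pc ν i o z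

/-- One-block recursion of the partial Green sums: `Σ_{b,b'} ν ν' Gm m (o + δ) z = Gm (m+1) o z - 𝟙[o = z]`. -/
theorem sum_Gm (pc : Fin np → List (Fin t × Bool)) (ν : Blk np k → ℝ) (m : ℕ) (o z : Off t k) :
    ∑ b : Blk np k, ∑ b' : Blk np k, ν b * ν b' * Gm pc ν m (o + δ pc b b') z =
      Gm pc ν (m + 1) o z - if o = z then 1 else 0 := by
  unfold Gm
  rw [sum_range_succ', Pn_zero, add_sub_cancel_right]
  simp_rw [mul_sum]
  rw [← Fintype.sum_prod_type', sum_comm]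
  refine sum_congr rfl fun i _ => ?_
  rw [Pn_succ, ← Fintype.sum_prod_type']

/-- **The Lyapunov step**: a sequence of potentials `V m ≥ c > 0` with
`Σ_{b,b'} ν ν' x^{R o b b'} V m (o + δ b b') ≤ V (m+1) o` dominates the pair sums: `A x m o ≤ V m o / c`. -/
theorem A_le_of_potential (R : Off t k → Blk np k → Blk np k → ℕ) (pc : Fin np → List (Fin t × Bool))
    {ν : Blk np k → ℝ} (hν : ∀ b, 0 ≤ ν b) {x : ℝ} (hx : 0 ≤ x) {V : ℕ → Off t k → ℝ} {c : ℝ} (hc : 0 < c)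
    (hV : ∀ m o, c ≤ V m o)
    (hstep : ∀ m o, ∑ b : Blk np k, ∑ b' : Blk np k, ν b * ν b' * x ^ R o b b' * V m (o + δ pc b b') ≤ V (m + 1) o) :
    ∀ m o, A R pc ν x m o ≤ V m o / c := by
  intro m
  induction m with
  | zero => intro o; rw [A_zero, le_div_iff₀ hc, one_mul]; exact hV 0 o
  | succ m ih =>
    intro o
    rw [A_succ, le_div_iff₀ hc]
    calc (∑ b : Blk np k, ∑ b' : Blk np k, ν b * ν b' * x ^ R o b b' * A R pc ν x m (o + δ pc b b')) * c
        = ∑ b : Blk np k, ∑ b' : Blk np k, ν b * ν b' * x ^ R o b b' * (A R pc ν x m (o + δ pc b b') * c) := by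
          rw [sum_mul]; refine sum_congr rfl fun b _ => ?_; rw [sum_mul]; refine sum_congr rfl fun b' _ => ?_; ring
      _ ≤ ∑ b : Blk np k, ∑ b' : Blk np k, ν b * ν b' * x ^ R o b b' * V m (o + δ pc b b') := by
          refine sum_le_sum fun b _ => sum_le_sum fun b' _ => mul_le_mul_of_nonneg_left ?_
            (mul_nonneg (mul_nonneg (hν b) (hν b')) (pow_nonneg hx _))
          rw [← le_div_iff₀ hc]; exact ih _
      _ ≤ V (m + 1) o := hstep m o

/-- **The certificate bound.**  Let `x ≥ 1`, `ν ≥ 0` with `Σ ν = 1`, a finite set `B` of offsets outside which the local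
count `R` vanishes, `φ ≥ 0` on `B`, `c > 0`, and `Ĝ` an upper bound for all partial Green sums towards `B`.  If

  `Σ_{b,b'} ν b ν b' (x^{R o b b'} - 1) (c + Σ_{z ∈ B} Ĝ (o + δ b b') z · φ z) ≤ φ o`  for every `o ∈ B`,

then `A x n 0 ≤ (c + Σ_{z∈B} Ĝ 0 z φ z) / c` for every `n`. -/
theorem A_le_of_cert (R : Off t k → Blk np k → Blk np k → ℕ) (pc : Fin np → List (Fin t × Bool))
    {ν : Blk np k → ℝ} (hν : ∀ b, 0 ≤ ν b) (hν1 : ∑ b : Blk np k, ν b = 1) {x : ℝ} (hx : 1 ≤ x)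
    (B : Finset (Off t k)) (hB : ∀ o b b', R o b b' ≠ 0 → o ∈ B) {φ : Off t k → ℝ} (hφ : ∀ z ∈ B, 0 ≤ φ z)
    {c : ℝ} (hc : 0 < c) {Ĝ : Off t k → Off t k → ℝ} (hĜ : ∀ m o, ∀ z ∈ B, Gm pc ν m o z ≤ Ĝ o z)
    (hcert : ∀ o ∈ B, ∑ b : Blk np k, ∑ b' : Blk np k,
      ν b * ν b' * (x ^ R o b b' - 1) * (c + ∑ z ∈ B, Ĝ (o + δ pc b b') z * φ z) ≤ φ o) (n : ℕ) :
    A R pc ν x n 0 ≤ (c + ∑ z ∈ B, Ĝ 0 z * φ z) / c := by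
  have hx0 : 0 ≤ x := zero_le_one.trans hx
  -- the finite-horizon potentials
  set V : ℕ → Off t k → ℝ := fun m o => c + ∑ z ∈ B, Gm pc ν m o z * φ z with hVdef
  have hGm0 : ∀ m o z, 0 ≤ Gm pc ν m o z := fun m o z => sum_nonneg fun i _ => Pn_nonneg pc hν i o z
  have hVc : ∀ m o, c ≤ V m o := fun m o =>
    le_add_of_nonneg_right (sum_nonneg fun z hz => mul_nonneg (hGm0 m o z) (hφ z hz))
  -- `V m ≤ c + Σ Ĝ φ`
  have hVle : ∀ m o, V m o ≤ c + ∑ z ∈ B, Ĝ o z * φ z := fun m o =>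
    add_le_add le_rfl (sum_le_sum fun z hz => mul_le_mul_of_nonneg_right (hĜ m o z hz) (hφ z hz))
  -- the harmonic part: `Σ νν' V m (o+δ) = V (m+1) o - φ̄ o`
  have hνν : ∑ b : Blk np k, ∑ b' : Blk np k, ν b * ν b' = 1 := by rw [← sum_mul_sum, hν1, one_mul]
  have harm : ∀ m o, ∑ b : Blk np k, ∑ b' : Blk np k, ν b * ν b' * V m (o + δ pc b b') =
      V (m + 1) o - ∑ z ∈ B, (if o = z then 1 else 0) * φ z := by
    intro m o
    have e1 : ∑ b : Blk np k, ∑ b' : Blk np k, ν b * ν b' * V m (o + δ pc b b') =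
        (∑ b : Blk np k, ∑ b' : Blk np k, ν b * ν b' * c) +
          ∑ b : Blk np k, ∑ b' : Blk np k, ∑ z ∈ B, φ z * (ν b * ν b' * Gm pc ν m (o + δ pc b b') z) := by
      rw [← sum_add_distrib]; refine sum_congr rfl fun b _ => ?_
      rw [← sum_add_distrib]; refine sum_congr rfl fun b' _ => ?_
      rw [hVdef]; dsimp only; rw [mul_add, mul_sum]; congr 1; exact sum_congr rfl fun z _ => by ring
    have e2 : ∑ b : Blk np k, ∑ b' : Blk np k, ν b * ν b' * c = c := by
      simp_rw [← sum_mul]; rw [hνν, one_mul]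
    have e3 : ∑ b : Blk np k, ∑ b' : Blk np k, ∑ z ∈ B, φ z * (ν b * ν b' * Gm pc ν m (o + δ pc b b') z) =
        ∑ z ∈ B, φ z * ∑ b : Blk np k, ∑ b' : Blk np k, ν b * ν b' * Gm pc ν m (o + δ pc b b') z := by
      rw [← Fintype.sum_prod_type', Finset.sum_comm]
      refine sum_congr rfl fun z _ => ?_
      rw [← Fintype.sum_prod_type', mul_sum]
    rw [e1, e2, e3]
    simp_rw [sum_Gm pc ν]
    rw [hVdef]; dsimp only
    rw [← sub_eq_zero]
    simp only [mul_sub, sum_sub_distrib]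
    have : ∑ z ∈ B, φ z * Gm pc ν (m + 1) o z = ∑ z ∈ B, Gm pc ν (m + 1) o z * φ z :=
      sum_congr rfl fun z _ => mul_comm _ _
    have : ∑ z ∈ B, φ z * (if o = z then (1 : ℝ) else 0) = ∑ z ∈ B, (if o = z then (1 : ℝ) else 0) * φ z :=
      sum_congr rfl fun z _ => mul_comm _ _
    linarith
  -- the reward part is controlled by the certificate
  have hrew : ∀ m o, ∑ b : Blk np k, ∑ b' : Blk np k,
      ν b * ν b' * (x ^ R o b b' - 1) * V m (o + δ pc b b') ≤ ∑ z ∈ B, (if o = z then 1 else 0) * φ z := by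
    intro m o
    have hR0 : ∀ b b', 0 ≤ ν b * ν b' * (x ^ R o b b' - 1) := fun b b' =>
      mul_nonneg (mul_nonneg (hν b) (hν b')) (sub_nonneg.2 (one_le_pow₀ hx))
    have hrhs : ∑ z ∈ B, (if o = z then (1 : ℝ) else 0) * φ z = if o ∈ B then φ o else 0 := by
      simp_rw [boole_mul]; exact sum_ite_eq B o φ
    rw [hrhs]
    by_cases ho : o ∈ B
    · rw [if_pos ho]
      refine le_trans ?_ (hcert o ho)
      exact sum_le_sum fun b _ => sum_le_sum fun b' _ => mul_le_mul_of_nonneg_left (hVle m _) (hR0 b b')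
    · rw [if_neg ho]
      refine le_of_eq (sum_eq_zero fun b _ => sum_eq_zero fun b' _ => ?_)
      have : R o b b' = 0 := by
        by_contra h; exact ho (hB o b b' h)
      rw [this, pow_zero, sub_self, mul_zero, zero_mul]
  -- the supermartingale step
  have hstep : ∀ m o, ∑ b : Blk np k, ∑ b' : Blk np k, ν b * ν b' * x ^ R o b b' * V m (o + δ pc b b') ≤
      V (m + 1) o := by
    intro m o
    have hsplit : ∑ b : Blk np k, ∑ b' : Blk np k, ν b * ν b' * x ^ R o b b' * V m (o + δ pc b b') =
        (∑ b : Blk np k, ∑ b' : Blk np k, ν b * ν b' * V m (o + δ pc b b')) +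
          ∑ b : Blk np k, ∑ b' : Blk np k, ν b * ν b' * (x ^ R o b b' - 1) * V m (o + δ pc b b') := by
      rw [← sum_add_distrib]; refine sum_congr rfl fun b _ => ?_
      rw [← sum_add_distrib]; refine sum_congr rfl fun b' _ => ?_
      ring
    have hφ0 : 0 ≤ ∑ z ∈ B, (if o = z then (1 : ℝ) else 0) * φ z :=
      sum_nonneg fun z hz => mul_nonneg (by split_ifs <;> norm_num) (hφ z hz)
    rw [hsplit, harm]
    linarith [hrew m o]
  exact (A_le_of_potential R pc hν hx0 hc hVc hstep n 0).trans (div_le_div_of_nonneg_right (hVle n 0) hc.le)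

end Summit.CriticalPhenomena.PercolationContinuityZ3.Theorems.Pcint.BSM

end
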